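import Literature.NumberTheory.EllipticCurves.SingularModuliPrincipalPrimes
import Literature.NumberTheory.QuadraticFields.LatticeSumPrincipal
import Literature.NumberTheory.QuadraticFields.HeegnerCondition
import HarnessLib

/-!
# Norms from the ring of integers of a quadratic field are values of the principal form
# (Cox, *Primes of the form x² + ny²*, §7.B Thm. 7.7 and (7.16))

Topic `NumberTheory/QuadraticFields`.  Theorem-only file (no definition, no named fact, D-0026).
For a quadratic field `K` (`[K:ℚ] = 2`) with an integral basis `(1, ω)`, `ω² = m + tω`
(`Literature.NumberTheory.QuadraticFields.Quadratic.exists_basis_zero_eq_one`,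
`basis_one_mul_self_eq`, `discr_eq_sq_add_four_mul`: `d_K = t² + 4m`):

* (the tree's `norm_intCast_add_intCast_mul`, `LatticeSumPrincipal.lean`: `N_{K/ℚ}(x + yω) =
  x² + txy − my²`, the norm form `(1, t, −m)` of discriminant `d_K`; Cox (7.16));
* `exists_principalForm_eq_norm` — every norm `N_{K/ℚ}(π)`, `π ∈ 𝓞 K`, is a value
  `x² + Bxy + Cy²` of the principal form `(1, B, C) = principalForm d_K` (forms `(1, ·, ·)` of equal
  discriminant represent the same integers, `exists_norm_repr_of_repr` of
  `EllipticCurves/SingularModuliPrincipalPrimes.lean`);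
* `exists_principalForm_eq_absNorm_span` — for `d_K < 0` (norms are then `≥ 0`): the absolute norm
  of every principal ideal `(π)` of `𝓞 K` is a value of the principal form; in particular a prime
  `p` below a principal prime of `𝓞 K` of norm `p` is represented by the principal form of
  discriminant `d_K` (Cox Thm. 7.7 (ii)–(iii) with Thm. 5.26: "`p = x² + ny²` ⟺ `p𝒪_K = 𝔭𝔭̄`,
  `𝔭` principal").

This is the bridge between the class-field-theoretic splitting law of the Hilbert class field
(primes of `K` split completely iff principal) and the splitting of principal-form primes in the
field of singular moduli (`exists_modulus_absNorm_eq_of_adjoin_singularModuli`), used towards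
Granville–Stark's Lemma 1 (`K(j(τ_D))/K` unramified).

## References

* D. A. Cox, *Primes of the form x² + ny²*, 2nd ed., Wiley 2013: §7.B Thm. 7.7, (7.16); §5.B
  Thm. 5.26; §2.C (principal form). [Cox2013]
-/

noncomputable section

open Module NumberField

namespace Literature.NumberTheory.QuadraticFields.Quadratic

open Literature.NumberTheory.QuadraticFields.BinaryQuadraticForm
open Literature.NumberTheory.EllipticCurves (exists_norm_repr_of_repr)

variable {K : Type*} [Field K] [NumberField K]

/-- **Every norm from `𝓞 K` is a value of the principal form of discriminant `d_K`** (`[K:ℚ] = 2`):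
for `π ∈ 𝓞 K` there are integers `x, y` with `N_{K/ℚ}(π) = x² + Bxy + Cy²`, where
`(1, B, C) = principalForm d_K`.  (Write `π = x + yω` in an integral basis `(1, ω)`; the norm form
`x² + txy − my²` has discriminant `t² + 4m = d_K` (`discr_eq_sq_add_four_mul`), and forms `(1, ·, ·)`
of the same discriminant represent the same integers, `exists_norm_repr_of_repr`.)  Cox, Thm. 7.7
(ii)/(7.16): the norms of elements of `𝒪` are the values of the principal form.
[cite: Cox2013, §7.B Thm. 7.7 and (7.16)] -/
theorem exists_principalForm_eq_norm (h2 : finrank ℚ K = 2) (π : 𝓞 K) :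
    ∃ x y : ℤ, x ^ 2 + (principalForm (NumberField.discr K)).2.1 * x * y +
      (principalForm (NumberField.discr K)).2.2 * y ^ 2 = Algebra.norm ℤ π := by
  obtain ⟨b, hb⟩ := exists_basis_zero_eq_one (K := K) h2
  set m : ℤ := b.repr (b 1 * b 1) 0 with hm
  set t : ℤ := b.repr (b 1 * b 1) 1 with ht
  -- `π = x + yω`
  set x : ℤ := b.repr π 0 with hx
  set y : ℤ := b.repr π 1 with hy
  have hπ : π = (x : 𝓞 K) + (y : 𝓞 K) * b 1 := by
    conv_lhs => rw [← b.sum_repr π]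
    rw [Fin.sum_univ_two, hb, zsmul_eq_mul, mul_one, zsmul_eq_mul]
  have hω : b 1 * b 1 = (m : 𝓞 K) + (t : 𝓞 K) * b 1 := basis_one_mul_self_eq b hb
  have hN : Algebra.norm ℤ π = x ^ 2 + t * x * y - m * y ^ 2 := by
    rw [hπ, norm_intCast_add_intCast_mul b hb hω]
  -- the norm form `(1, t, -m)` has discriminant `d_K`
  have hD : NumberField.discr K = t ^ 2 + 4 * m := discr_eq_sq_add_four_mul b hb
  have h4 : NumberField.discr K % 4 = 0 ∨ NumberField.discr K % 4 = 1 := discr_emod_four h2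
  have hP : (principalForm (NumberField.discr K)).2.1 ^ 2 - 4 * (principalForm (NumberField.discr K)).2.2
      = NumberField.discr K := by
    have h1 := discr_principalForm h4
    have h2' : discr (principalForm (NumberField.discr K)) = (principalForm (NumberField.discr K)).2.1 ^ 2 -
        4 * (principalForm (NumberField.discr K)).1 * (principalForm (NumberField.discr K)).2.2 := rfl
    rw [principalForm_fst] at h2'
    linear_combination -h2' + h1
  -- transfer from `(1, t, -m)` to the principal form: `u² − B u v + C v²`, then `v ↦ −v`
  have hrep : x ^ 2 + t * x * y + (-m) * y ^ 2 = Algebra.norm ℤ π := by rw [hN]; ring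
  have hdisc : t ^ 2 - 4 * (-m) = (principalForm (NumberField.discr K)).2.1 ^ 2 -
      4 * 1 * (principalForm (NumberField.discr K)).2.2 := by
    linear_combination -hD - hP
  obtain ⟨u, v, huv⟩ := exists_norm_repr_of_repr (a := 1) hdisc hrep
  refine ⟨u, -v, ?_⟩
  linear_combination huv

/-- Hence **a principal ideal of norm `n` makes `n` a value of the principal form** when `K` is
imaginary quadratic (`d_K < 0`, so that norms are non-negative): if `(π)` has absolute norm `n` then
`n = x² + Bxy + Cy²` with `(1, B, C) = principalForm d_K` — in particular a prime `p` with a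
principal prime of `𝓞 K` of norm `p` above it is represented by the principal form (Cox Thm. 7.7,
Cor. 7.? / §9.A: "`p = x² + ny²` iff `p𝒪_K = 𝔭𝔭̄` with `𝔭` principal").
[cite: Cox2013, §7.B Thm. 7.7; §5.B Thm. 5.26] -/
theorem exists_principalForm_eq_absNorm_span (h2 : finrank ℚ K = 2) (hneg : NumberField.discr K < 0)
    (π : 𝓞 K) :
    ∃ x y : ℤ, x ^ 2 + (principalForm (NumberField.discr K)).2.1 * x * y +
      (principalForm (NumberField.discr K)).2.2 * y ^ 2 = Ideal.absNorm (Ideal.span {π}) := by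
  obtain ⟨x, y, hxy⟩ := exists_principalForm_eq_norm h2 π
  refine ⟨x, y, ?_⟩
  rw [Ideal.absNorm_span_singleton, hxy]
  -- the norm is non-negative for `d_K < 0`: `4·(x² + Bxy + Cy²) = (2x + By)² − d_K y²`
  have h4 : NumberField.discr K % 4 = 0 ∨ NumberField.discr K % 4 = 1 := discr_emod_four h2
  have hP : (principalForm (NumberField.discr K)).2.1 ^ 2 - 4 * (principalForm (NumberField.discr K)).2.2
      = NumberField.discr K := by
    have h1 := discr_principalForm h4
    have h2' : discr (principalForm (NumberField.discr K)) = (principalForm (NumberField.discr K)).2.1 ^ 2 -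
        4 * (principalForm (NumberField.discr K)).1 * (principalForm (NumberField.discr K)).2.2 := rfl
    rw [principalForm_fst] at h2'
    linear_combination -h2' + h1
  have hnn : 0 ≤ Algebra.norm ℤ π := by
    rw [← hxy]
    nlinarith [sq_nonneg (2 * x + (principalForm (NumberField.discr K)).2.1 * y), sq_nonneg y, hP, hneg]
  exact (Int.natAbs_of_nonneg hnn).symm ▸ rfl

end Literature.NumberTheory.QuadraticFields.Quadratic

end
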